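import Mathlib.LinearAlgebra.Eigenspace.Triangularizable
import Literature.RepresentationTheory.FiniteGroups.MonomialCharacters
import HarnessLib

/-!
# Gelfand's lemma: a commutative Hecke algebra forces multiplicity one

Topic `Literature/RepresentationTheory/FiniteGroups`.  Let `G` be a finite group, `U ≤ G` a
subgroup and `λ : U → ℂˣ` a linear character.  The **Hecke algebra** `ℋ(G, U, λ)` is the
convolution algebra of functions `f : G → ℂ` with `f(u x) = λ(u) f(x)` and `f(x u) = f(x) λ(u)`
(`IsHeckeFunction`, `conv`); it is anti-isomorphic to `End_G(Ind_U^G λ)` (Curtis–Reiner, *Methods of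
Representation Theory* I, (11.30); Bump, *Automorphic Forms and Representations*, §4.1).

* `finrank_weightSpace_le_one_of_conv_comm` — **Gelfand's lemma** (Bump, Prop. 4.1.1 / Thm. 4.1.2's
  proof; Carter, *Finite Groups of Lie Type*, §8.1): if `ℋ(G, U, λ)` is commutative, then for every
  irreducible complex representation `ρ` of `G` on `W` the `λ`-eigenspace
  `W_λ = {w | ρ(u) w = λ(u) w}` (`weightSpace`, i.e. `Hom_U(λ, Res ρ)`, whose dimension is the
  multiplicity of `ρ` in `Ind_U^G λ`) has dimension `≤ 1`.  Proof WITHOUT Burnside's theorem: the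
  Hecke functions `f_x = λ ⋆ δ_x ⋆ λ` act on `W` (Serre's `ρ_f = ∑ f(t) ρ(t⁻¹)`, `weightedSum`) as
  `T_x = Q ρ(x⁻¹) Q` with `Q = ∑_u λ(u) ρ(u⁻¹)` (`= |U|` times the projector onto `W_λ`); they
  commute, every non-zero `w ∈ W_λ` is cyclic for them (`W_λ = Q(W) = Q(span ρ(G) w) = span T_x w` by
  irreducibility), so an eigenvector of `T_x` in `W_λ` makes `T_x` a scalar on `W_λ`, and then
  `W_λ = span {T_x w} ⊆ ℂ w`.
* `conv_comm_of_antiInvolution` — **Gelfand's trick**: if an anti-automorphism `ι` of `G` fixes every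
  Hecke function (`f ∘ ι = f`), the Hecke algebra is commutative
  (`(f ⋆ g) ∘ ι = (g ∘ ι) ⋆ (f ∘ ι)`).

Used for the Gelfand–Graev representation of `GL_n(𝔽_q)` (uniqueness of Whittaker models).
Definitions introduced: `conv`, `IsHeckeFunction` (both elementary); the eigenspace is the tree's
`weightSpace`.

## References

* D. Bump, *Automorphic Forms and Representations*, Cambridge 1997, §4.1 (Prop. 4.1.1, Thm. 4.1.2).
* R. W. Carter, *Finite Groups of Lie Type*, Wiley 1985, §8.1.
* J.-P. Serre, *Linear Representations of Finite Groups*, §2.5 (the operators `ρ_f`)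
  [SerreLinearRepresentations1977].
-/

noncomputable section

open scoped BigOperators
open Module

namespace Literature.RepresentationTheory.FiniteGroups

variable {G : Type} [Group G] [Fintype G]

/-! ### Convolution and Hecke functions -/

/-- **Convolution** of complex functions on a finite group: `(f ⋆ g)(x) = ∑_y f(y) g(y⁻¹ x)`
(the product of the group algebra `ℂ[G]` on coefficient functions). [folklore] -/
def conv (f g : G → ℂ) (x : G) : ℂ :=
  ∑ y : G, f y * g (y⁻¹ * x)

/-- `f` is a **`(U, λ)`-Hecke function** (an element of the Hecke algebra `ℋ(G, U, λ)`):
`f(u x) = λ(u) f(x)` and `f(x u) = f(x) λ(u)` for `u ∈ U` (Curtis–Reiner (11.30); Bump §4.1). [folklore] -/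
def IsHeckeFunction (U : Subgroup G) (lam : U →* ℂˣ) (f : G → ℂ) : Prop :=
  ∀ (u : U) (x : G), f (u * x) = (lam u : ℂ) * f x ∧ f (x * u) = f x * (lam u : ℂ)

/-- Serre's operator is anti-multiplicative for convolution: `ρ_{f ⋆ g} = ρ_g ∘ ρ_f`. [folklore] -/
theorem weightedSum_conv {V : Type*} [AddCommGroup V] [Module ℂ V] (ρ : Representation ℂ G V)
    (f g : G → ℂ) :
    Representation.weightedSum ρ (conv f g) =
      Representation.weightedSum ρ g ∘ₗ Representation.weightedSum ρ f := by
  refine LinearMap.ext fun v => ?_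
  rw [LinearMap.comp_apply, Representation.weightedSum_apply, Representation.weightedSum_apply,
    Representation.weightedSum_apply]
  have lhs : ∑ x : G, conv f g x • ρ x⁻¹ v = ∑ y : G, ∑ z : G, (f y * g z) • ρ (y * z)⁻¹ v := by
    simp only [conv, Finset.sum_smul]
    rw [Finset.sum_comm]
    refine Finset.sum_congr rfl fun y _ => ?_
    exact Fintype.sum_equiv (Equiv.mulLeft y⁻¹) _ _ fun x => by simp
  have rhs : ∑ z : G, g z • ρ z⁻¹ (∑ y : G, f y • ρ y⁻¹ v) =
      ∑ y : G, ∑ z : G, (f y * g z) • ρ (y * z)⁻¹ v := by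
    simp only [map_sum, map_smul, Finset.smul_sum]
    rw [Finset.sum_comm]
    refine Finset.sum_congr rfl fun y _ => Finset.sum_congr rfl fun z _ => ?_
    rw [smul_smul, mul_comm, mul_inv_rev, map_mul, Module.End.mul_apply]
  rw [lhs, rhs]

/-! ### Gelfand's lemma -/

section Gelfand

variable [DecidableEq G] (U : Subgroup G) [Fintype U] (lam : U →* ℂˣ)
  {W : Type} [AddCommGroup W] [Module ℂ W] (ρ : Representation ℂ G W)

/-- The averaging operator `Q = ∑_{u ∈ U} λ(u) ρ(u⁻¹)` (`|U|` times the projector onto the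
`λ`-eigenspace). [folklore] -/
def heckeAverage : W →ₗ[ℂ] W :=
  ∑ u : U, (lam u : ℂ) • ρ ((u : G)⁻¹)

omit [Fintype G] [DecidableEq G] in
/-- `Q` takes values in the `λ`-eigenspace: `ρ(u₀) Q = λ(u₀) Q`. [folklore] -/
theorem apply_heckeAverage (u₀ : U) (w : W) :
    ρ u₀ (heckeAverage U lam ρ w) = (lam u₀ : ℂ) • heckeAverage U lam ρ w := by
  simp only [heckeAverage, LinearMap.sum_apply, LinearMap.smul_apply, map_sum, map_smul, Finset.smul_sum]
  -- reindex `u ↦ u u₀⁻¹`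
  refine Fintype.sum_equiv (Equiv.mulRight u₀⁻¹) _ _ fun u => ?_
  simp only [Equiv.coe_mulRight, Subgroup.coe_mul, Subgroup.coe_inv, mul_inv_rev, inv_inv, map_mul,
    smul_smul, Units.val_mul]
  rw [← Module.End.mul_apply, ← map_mul]
  congr 1
  have h : (lam u₀⁻¹ : ℂ) * (lam u₀ : ℂ) = 1 := by
    rw [← Units.val_mul, ← map_mul, inv_mul_cancel, map_one, Units.val_one]
  calc (lam u : ℂ) = (lam u : ℂ) * ((lam u₀⁻¹ : ℂ) * (lam u₀ : ℂ)) := by rw [h, mul_one]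
    _ = (lam u₀ : ℂ) * ((lam u : ℂ) * (lam u₀⁻¹ : ℂ)) := by ring
    _ = _ := by rw [map_inv, Units.val_inv_eq_inv_val]

omit [Fintype G] [DecidableEq G] in
/-- The image of `Q` lies in the weight space `W_λ`. [folklore] -/
theorem heckeAverage_mem_weightSpace (w : W) :
    heckeAverage U lam ρ w ∈ weightSpace ρ U (fun u => (lam u : ℂ)) :=
  fun u₀ => apply_heckeAverage U lam ρ u₀ w

omit [Fintype G] [DecidableEq G] in
/-- On the weight space, `Q` is multiplication by `|U|`. [folklore] -/
theorem heckeAverage_apply_of_mem {w : W} (hw : w ∈ weightSpace ρ U (fun u => (lam u : ℂ))) :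
    heckeAverage U lam ρ w = (Fintype.card U : ℂ) • w := by
  simp only [heckeAverage, LinearMap.sum_apply, LinearMap.smul_apply]
  have h : ∀ u : U, (lam u : ℂ) • ρ ((u : G)⁻¹) w = w := by
    intro u
    have hu := hw u⁻¹
    simp only [Subgroup.coe_inv, map_inv, Units.val_inv_eq_inv_val] at hu
    rw [hu, smul_smul, mul_inv_cancel₀ (Units.ne_zero _), one_smul]
  simp only [h, Finset.sum_const, Finset.card_univ, Nat.cast_smul_eq_nsmul]

/-- The Hecke function `f_x = λ ⋆ δ_x ⋆ λ`: `f_x(y) = ∑_{u x u' = y} λ(u) λ(u')`. [folklore] -/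
def heckeBasisFun (x : G) (y : G) : ℂ :=
  ∑ u : U, ∑ u' : U, if (u : G) * x * u' = y then (lam u : ℂ) * (lam u' : ℂ) else 0

omit [Fintype G] in
/-- `f_x` is a Hecke function. [folklore] -/
theorem isHeckeFunction_heckeBasisFun (x : G) : IsHeckeFunction U lam (heckeBasisFun U lam x) := by
  intro u₀ y
  constructor
  · simp only [heckeBasisFun, Finset.mul_sum]
    -- reindex the outer sum `u ↦ u₀ u`
    refine (Fintype.sum_equiv (Equiv.mulLeft u₀) _ _ fun u => ?_).symm
    refine Finset.sum_congr rfl fun u' _ => ?_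
    simp only [Equiv.coe_mulLeft, Subgroup.coe_mul, map_mul, Units.val_mul]
    have hiff : (u₀ : G) * u * x * u' = u₀ * y ↔ (u : G) * x * u' = y := by
      constructor
      · intro h; apply mul_left_cancel (a := (u₀ : G)); simpa [mul_assoc] using h
      · intro h; rw [← h]; simp [mul_assoc]
    by_cases h : (u : G) * x * u' = y
    · rw [if_pos (hiff.mpr h), if_pos h]; ring
    · rw [if_neg (fun h' => h (hiff.mp h')), if_neg h, mul_zero]
  · simp only [heckeBasisFun, Finset.sum_mul]
    refine Finset.sum_congr rfl fun u _ => ?_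
    -- reindex the inner sum `u' ↦ u' u₀`
    refine (Fintype.sum_equiv (Equiv.mulRight u₀) _ _ fun u' => ?_).symm
    simp only [Equiv.coe_mulRight, Subgroup.coe_mul, map_mul, Units.val_mul]
    have hiff : (u : G) * x * (u' * u₀) = y * u₀ ↔ (u : G) * x * u' = y := by
      constructor
      · intro h; apply mul_right_cancel (b := (u₀ : G)); simpa [mul_assoc] using h
      · intro h; rw [← h]; simp [mul_assoc]
    by_cases h : (u : G) * x * u' = y
    · rw [if_pos (hiff.mpr h), if_pos h]; ring
    · rw [if_neg (fun h' => h (hiff.mp h')), if_neg h, zero_mul]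

/-- `ρ_{f_x} = Q ρ(x⁻¹) Q`. [folklore] -/
theorem weightedSum_heckeBasisFun (x : G) :
    Representation.weightedSum ρ (heckeBasisFun U lam x) =
      heckeAverage U lam ρ ∘ₗ ρ x⁻¹ ∘ₗ heckeAverage U lam ρ := by
  refine LinearMap.ext fun w => ?_
  have lhs : Representation.weightedSum ρ (heckeBasisFun U lam x) w =
      ∑ u : U, ∑ u' : U, ((lam u : ℂ) * (lam u' : ℂ)) • ρ ((u : G) * x * u')⁻¹ w := by
    rw [Representation.weightedSum_apply]
    simp only [heckeBasisFun, Finset.sum_smul, ite_smul, zero_smul]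
    rw [Finset.sum_comm]
    refine Finset.sum_congr rfl fun u _ => ?_
    rw [Finset.sum_comm]
    refine Finset.sum_congr rfl fun u' _ => ?_
    rw [Finset.sum_ite_eq, if_pos (Finset.mem_univ _)]
  have rhs : (heckeAverage U lam ρ ∘ₗ ρ x⁻¹ ∘ₗ heckeAverage U lam ρ) w =
      ∑ u : U, ∑ u' : U, ((lam u : ℂ) * (lam u' : ℂ)) • ρ ((u : G) * x * u')⁻¹ w := by
    simp only [heckeAverage, LinearMap.coe_comp, Function.comp_apply, LinearMap.sum_apply,
      LinearMap.smul_apply, map_sum, map_smul, Finset.smul_sum]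
    refine Finset.sum_congr rfl fun u _ => Finset.sum_congr rfl fun u' _ => ?_
    rw [smul_smul, ← Module.End.mul_apply, ← Module.End.mul_apply, ← map_mul, ← map_mul]
    congr 2
    simp only [mul_inv_rev, mul_assoc]
  rw [lhs, rhs]

/-- **Gelfand's lemma** (Bump, *Automorphic Forms and Representations*, Prop. 4.1.1 with the
proof of Thm. 4.1.2; Carter §8.1): if the Hecke algebra `ℋ(G, U, λ)` is commutative, then for every
irreducible representation `ρ` of `G` the `λ`-eigenspace of `U` has dimension at most `1` — i.e.
`Ind_U^G λ` is multiplicity-free.  See the module docstring for the Burnside-free proof. [folklore] -/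
theorem finrank_weightSpace_le_one_of_conv_comm
    (hcomm : ∀ f g : G → ℂ, IsHeckeFunction U lam f → IsHeckeFunction U lam g → conv f g = conv g f)
    [FiniteDimensional ℂ W] (hρ : ρ.IsIrreducible) :
    finrank ℂ (weightSpace ρ U (fun u => (lam u : ℂ))) ≤ 1 := by
  set Wl := weightSpace ρ U (fun u => (lam u : ℂ)) with hWl
  set Q := heckeAverage U lam ρ with hQ
  set T : G → W →ₗ[ℂ] W := fun x => Q ∘ₗ ρ x ∘ₗ Q with hT
  -- (1) the `T x` commute
  have hTcomm : ∀ x y : G, T x ∘ₗ T y = T y ∘ₗ T x := by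
    intro x y
    have h := congrArg (Representation.weightedSum ρ)
      (hcomm _ _ (isHeckeFunction_heckeBasisFun U lam y⁻¹) (isHeckeFunction_heckeBasisFun U lam x⁻¹))
    rw [weightedSum_conv, weightedSum_conv, weightedSum_heckeBasisFun, weightedSum_heckeBasisFun,
      inv_inv, inv_inv] at h
    exact h
  -- (2) `T x` maps into `Wl`, and `Q = |U|` on `Wl`
  have hTmem : ∀ (x : G) (w : W), T x w ∈ Wl := fun x w => heckeAverage_mem_weightSpace U lam ρ _
  have hcard : (Fintype.card U : ℂ) ≠ 0 := Nat.cast_ne_zero.mpr Fintype.card_ne_zero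
  -- (3) cyclicity: every `v ∈ Wl` lies in the span of the `T x w`, for any non-zero `w ∈ Wl`
  have hcyc : ∀ w ∈ Wl, w ≠ 0 → ∀ v ∈ Wl, v ∈ Submodule.span ℂ (Set.range fun x => T x w) := by
    intro w hw hw0 v hv
    -- the orbit of `w` spans `W`
    let S : Subrepresentation ρ :=
      { toSubmodule := Submodule.span ℂ (Set.range fun x => ρ x w)
        apply_mem_toSubmodule := fun g v hv => by
          refine Submodule.span_induction ?_ ?_ ?_ ?_ hv
          · rintro _ ⟨x, rfl⟩
            rw [← Module.End.mul_apply, ← map_mul]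
            exact Submodule.subset_span ⟨g * x, rfl⟩
          · simp
          · intro a b _ _ ha hb
            rw [map_add]
            exact Submodule.add_mem _ ha hb
          · intro c a _ ha
            rw [map_smul]
            exact Submodule.smul_mem _ c ha }
    haveI := hρ
    have hS : S = ⊤ := by
      rcases eq_bot_or_eq_top S with h | h
      · exfalso
        apply hw0
        have hmem : w ∈ S.toSubmodule := Submodule.subset_span ⟨1, by simp⟩
        have h' : S.toSubmodule = ⊥ := congrArg Subrepresentation.toSubmodule h
        rw [h'] at hmem
        exact (Submodule.mem_bot ℂ).mp hmem
      · exact h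
    have hvS : v ∈ S.toSubmodule := by
      have h' : S.toSubmodule = ⊤ := congrArg Subrepresentation.toSubmodule hS
      rw [h']
      exact Submodule.mem_top
    obtain ⟨c, hc⟩ := (Submodule.mem_span_range_iff_exists_fun ℂ).mp hvS
    -- apply `Q` : `|U| v = ∑ c_x Q ρ(x) w = |U|⁻¹ ∑ c_x T_x w`
    have hQv : Q v = (Fintype.card U : ℂ) • v := heckeAverage_apply_of_mem U lam ρ hv
    have hQw : Q w = (Fintype.card U : ℂ) • w := heckeAverage_apply_of_mem U lam ρ hw
    have key : v = ∑ x, ((Fintype.card U : ℂ)⁻¹ * (Fintype.card U : ℂ)⁻¹ * c x) • T x w := by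
      have h1 : Q v = ∑ x, c x • Q (ρ x w) := by
        rw [← hc, map_sum]
        simp only [map_smul]
      have h2 : ∀ x, Q (ρ x w) = (Fintype.card U : ℂ)⁻¹ • T x w := by
        intro x
        simp only [hT, LinearMap.coe_comp, Function.comp_apply, hQw, map_smul, smul_smul,
          inv_mul_cancel₀ hcard, one_smul]
      rw [hQv] at h1
      simp only [h2, smul_smul] at h1
      calc v = (Fintype.card U : ℂ)⁻¹ • ((Fintype.card U : ℂ) • v) := by
            rw [smul_smul, inv_mul_cancel₀ hcard, one_smul]
        _ = _ := by
            rw [h1, Finset.smul_sum]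
            refine Finset.sum_congr rfl fun x _ => ?_
            rw [smul_smul]
            congr 1
            ring
    rw [key]
    exact Submodule.sum_mem _ fun x _ => Submodule.smul_mem _ _ (Submodule.subset_span ⟨x, rfl⟩)
  -- (4) each `T x` is a scalar on `Wl`
  have hscalar : ∀ x : G, ∃ μ : ℂ, ∀ v ∈ Wl, T x v = μ • v := by
    intro x
    by_cases hbot : Wl = ⊥
    · exact ⟨0, fun v hv => by rw [hbot] at hv; rw [(Submodule.mem_bot ℂ).mp hv]; simp⟩
    · -- restrict `T x` to `Wl` and take an eigenvector
      haveI : Nontrivial Wl := Submodule.nontrivial_iff_ne_bot.mpr hbot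
      let Tx : Wl →ₗ[ℂ] Wl := (T x).restrict fun v _ => hTmem x v
      obtain ⟨μ, hμ⟩ := Module.End.exists_eigenvalue Tx
      obtain ⟨w, hw⟩ := hμ.exists_hasEigenvector
      have hw0 : (w : W) ≠ 0 := fun h => hw.2 (Subtype.ext h)
      have hTw : T x w = μ • (w : W) := by
        have := hw.apply_eq_smul
        exact congrArg Subtype.val this
      refine ⟨μ, fun v hv => ?_⟩
      -- `v` is in the span of the `T y w`, on which `T x` acts by `μ`
      have hv' := hcyc w w.2 hw0 v hv
      refine Submodule.span_induction ?_ ?_ ?_ ?_ hv'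
      · rintro _ ⟨y, rfl⟩
        calc T x (T y w) = T y (T x w) := by
              rw [← LinearMap.comp_apply, hTcomm x y, LinearMap.comp_apply]
          _ = μ • T y w := by rw [hTw, map_smul]
      · simp
      · intro a b _ _ ha hb
        rw [map_add, ha, hb, smul_add]
      · intro c a _ ha
        rw [map_smul, ha, smul_comm]
  -- (5) conclusion: `Wl ⊆ ℂ w` for any non-zero `w ∈ Wl`
  by_cases hbot : Wl = ⊥
  · rw [hbot, finrank_bot]
    exact Nat.zero_le 1
  · obtain ⟨w, hw, hw0⟩ := (Submodule.ne_bot_iff Wl).mp hbot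
    have hle : Wl ≤ Submodule.span ℂ {w} := by
      intro v hv
      have hv' := hcyc w hw hw0 v hv
      refine (Submodule.span_le.mpr ?_) hv'
      rintro _ ⟨x, rfl⟩
      obtain ⟨μ, hμ⟩ := hscalar x
      show T x w ∈ Submodule.span ℂ {w}
      rw [hμ w hw]
      exact Submodule.smul_mem _ _ (Submodule.subset_span rfl)
    calc finrank ℂ Wl ≤ finrank ℂ (Submodule.span ℂ ({w} : Set W)) := Submodule.finrank_mono hle
      _ ≤ ({w} : Set W).toFinset.card := finrank_span_le_card _
      _ = 1 := by simp

end Gelfand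

/-! ### Gelfand's trick: an anti-involution fixing the Hecke functions -/

/-- Convolution and anti-automorphisms: `(f ⋆ g) ∘ ι = (g ∘ ι) ⋆ (f ∘ ι)` for a bijection `ι`
with `ι(x y) = ι(y) ι(x)`. [folklore] -/
theorem conv_comp_antihom (ι : G ≃ G) (hι : ∀ x y : G, ι (x * y) = ι y * ι x) (f g : G → ℂ) :
    conv f g ∘ ι = conv (g ∘ ι) (f ∘ ι) := by
  have h1 : ι 1 = 1 := by
    have := hι 1 1
    rw [mul_one] at this
    exact mul_left_cancel (this.symm.trans (mul_one _).symm)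
  have hinv : ∀ z : G, ι z⁻¹ = (ι z)⁻¹ := by
    intro z
    apply eq_inv_of_mul_eq_one_left
    rw [← hι, mul_inv_cancel, h1]
  funext x
  simp only [Function.comp_apply, conv]
  calc ∑ y, f y * g (y⁻¹ * ι x) = ∑ z, f (ι z) * g ((ι z)⁻¹ * ι x) :=
        (Fintype.sum_equiv ι _ _ fun z => rfl).symm
    _ = ∑ z, f (ι z) * g (ι (x * z⁻¹)) := by
        refine Finset.sum_congr rfl fun z _ => ?_
        rw [hι, hinv]
    _ = ∑ t, g (ι t) * f (ι (t⁻¹ * x)) := by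
        refine Fintype.sum_equiv ((Equiv.inv G).trans (Equiv.mulLeft x)) _ _ fun z => ?_
        simp only [Equiv.trans_apply, Equiv.inv_apply, Equiv.coe_mulLeft, mul_inv_rev, inv_inv,
          inv_mul_cancel_right]
        rw [mul_comm]

/-- **Gelfand's trick**: if an anti-automorphism `ι` of `G` (a bijection with `ι(xy) = ι(y)ι(x)`)
fixes every `(U, λ)`-Hecke function, then the Hecke algebra `ℋ(G, U, λ)` is commutative
(Bump §4.1; Carter §8.1). [folklore] -/
theorem conv_comm_of_antiInvolution (U : Subgroup G) (lam : U →* ℂˣ) (ι : G ≃ G)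
    (hι : ∀ x y : G, ι (x * y) = ι y * ι x)
    (hfix : ∀ f : G → ℂ, IsHeckeFunction U lam f → f ∘ ι = f)
    (hconv : ∀ f g : G → ℂ, IsHeckeFunction U lam f → IsHeckeFunction U lam g →
      IsHeckeFunction U lam (conv f g))
    (f g : G → ℂ) (hf : IsHeckeFunction U lam f) (hg : IsHeckeFunction U lam g) :
    conv f g = conv g f := by
  calc conv f g = conv f g ∘ ι := (hfix _ (hconv f g hf hg)).symm
    _ = conv (g ∘ ι) (f ∘ ι) := conv_comp_antihom ι hι f g
    _ = conv g f := by rw [hfix g hg, hfix f hf]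

/-- Convolution of Hecke functions is a Hecke function. [folklore] -/
theorem IsHeckeFunction.conv {U : Subgroup G} {lam : U →* ℂˣ} {f g : G → ℂ}
    (hf : IsHeckeFunction U lam f) (hg : IsHeckeFunction U lam g) : IsHeckeFunction U lam (conv f g) := by
  intro u x
  constructor
  · simp only [Literature.RepresentationTheory.FiniteGroups.conv, Finset.mul_sum]
    -- substitute `y = u z`
    refine (Fintype.sum_equiv (Equiv.mulLeft (u : G)) _ _ fun z => ?_).symm
    simp only [Equiv.coe_mulLeft, mul_inv_rev]
    have hz : z⁻¹ * (u : G)⁻¹ * ((u : G) * x) = z⁻¹ * x := by group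
    rw [(hf u z).1, hz, mul_assoc]
  · simp only [Literature.RepresentationTheory.FiniteGroups.conv, Finset.sum_mul]
    refine Finset.sum_congr rfl fun y _ => ?_
    rw [← mul_assoc, (hg u (y⁻¹ * x)).2, mul_assoc]

end Literature.RepresentationTheory.FiniteGroups

end
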